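import Mathlib
import HarnessLib
import Literature.Analysis.Fourier.SublevelSetEstimate
import Summits.HubbardSuperconductivity.HubbardSuperconductivity.Theorems.KLProgrammeC4aFoldLevelSets

/-!
# Route `KLProgramme` — crux C4a, S3 brick (B4)/(B5) «(B4)-ABS-BUBBLE», part 1: SUBLEVEL COUNTING — the loop-angle measure of a thin shell
# `{φ : |ē(φ)| < s}` of the partner band under a DICHOTOMY hypothesis (van der Corput sublevel lemmas, localised on a grid)

Cell `gate-hubbard-kl`, seat hubbard-kl-k3c3-p3 (g26; row «implicit-function / monotonicity route for μ(n)»).  Located brick for the (C)-closer lane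
hubbard-kl-c4a-1 (stub (C) `stub_twoLeg_curvature` of `KLRegimeEngineV17F2`, stmt-HubbardSuperconductivity-20437), C4A-PLAN §24.4–§24.6 (B4)/(B5) and
HOME/hubbard-kl-k3c3-p3/B4-DIRECT-COUNT.md §2: after ENVELOPE PRESERVATION (`…C4aEnvelopePreservation`) every base-angle jet of the direct-sheet bubble is
bounded by the ABSOLUTE bubble, whose loop integrand is the envelope `1/max(t,|ē(e,φ;ρ,ϑ,θ)|)` of the coarser propagator (`t ≥ max(m,|e|)` after the finer-line
split `…C4aBubbleFinerLineSplit`).  Parts 1–2 price the loop-angle integral of that envelope by the PUSHFORWARD OF THE LOOP ANGLE UNDER THE LEVEL MAP (this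
row's device) in a form that needs NO location of the crossings and serves the tangency (fold), generic, umklapp-transversal and umklapp-caustic
configurations alike.  This part: the distribution function.

* §1 ONE CELL.  On a convex cell `D` where `g` oscillates by `≤ ℓ` (`s + ℓ ≤ κ`), the FIRST-ORDER DICHOTOMY `|g| ≤ κ → c₁ ≤ |g′|` gives
  `vol{x ∈ D : |g x| < s} ≤ 2s/c₁` (`volume_sublevel_cell_le_of_dichotomy_one`); the SECOND-ORDER DICHOTOMY `|g| ≤ κ → |g′| < c₁ → c₂ ≤ |g″|` (with `g′`
  oscillating by `≤ c₁/2`) gives `≤ 4s/c₁ + 6√(s/c₂)` (`volume_sublevel_cell_le_of_dichotomy_two`) — the tree's van der Corput sublevel lemmas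
  `Literature.Analysis.Fourier.volume_sublevel_le_of_le_abs_deriv(2)` [Christ 1985; Carbery–Christ–Wright 1999 §2], localised: if the cell meets the
  shell at all, the whole cell lies in `{|g| ≤ κ}`, where the dichotomy decides between a slope floor and a curvature floor ON THE WHOLE CELL.
* §2 GRID.  `volume_sublevel_Icc_le_mul_of_cells`: if every subinterval of `[A,B]` of length `≤ h` obeys a bound `V`, an interval of length `≤ N·h` obeys
  `N·V` (induction, `measure_union_le`); whence **`volume_sublevel_Icc_le_of_dichotomy_one`** / **`_two`**: with the slope ceiling `|g′| ≤ L₁` (and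
  `|g″| ≤ L₂`), `vol{x ∈ [a,b] : |g x| < s} ≤ N·(2s/c₁)` resp. `≤ N·(4s/c₁ + 6√(s/c₂))` for `s ≤ κ/2` (`0 < s`), `N` any natural with `(b − a)·2L₁ ≤ N·κ`
  (resp. also `(b − a)·4L₂ ≤ N·c₁`).
Part 2 (`…C4aEnvelopeLayerCake`) turns these into `∫ dx/max(t,|g x|) ≤ 2(b−a)/κ + (2N/c₁)·log⁺(κ/(2t))` (`+ 12N/√(c₂t)`).

How the (C)-closer feeds it (memo HOME/hubbard-kl-k3c3-p3/B4-ABS-BUBBLE.md): `g = φ ↦ ē(e,φ;ρ,ϑ,θ)` on the loop circle `[θ−π, θ+π]`; `L₁, L₂` = the tables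
`…C4aPartnerBandJetTables`; the dichotomy constants from `…C4aLoopNondegeneracy` (away from (C)/(T): first order), `…C4aTwoNodeCurvatureWindow` (near (T):
second order), the umklapp crossing slopes (`…C4aLoopAlignmentSheets`); the Cooper configuration is part 3 (`…C4aSublevelCountingCooper`).  Carrier-free
(`g : ℝ → ℝ`); nothing about the Hubbard model's sizes; nothing asserts (C), K3 or superconductivity.
References: FST II = Feldman–Salmhofer–Trubowitz, CPAM 51 (1998) §3 [cite: FeldmanSalmhoferTrubowitz1998]; BGM 2006 §2.4, App. A2
[cite: BenfattoGiulianiMastropietro2006]; Carbery–Christ–Wright, JAMS 12 (1999) §2 (sublevel set lemma).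
-/

noncomputable section

namespace Summit.HubbardSuperconductivity.HubbardSuperconductivity.Theorems.C4a

set_option linter.dupNamespace false -- summit = problem name (single-conjunct summit), D-0017

open Real Set Filter MeasureTheory intervalIntegral
open scoped Topology ENNReal

/-! ## §1 One cell: the van der Corput sublevel lemmas under a dichotomy hypothesis -/

section Cell

variable {g : ℝ → ℝ} {D : Set ℝ}

/-- Oscillation control: if `|g x − g y| ≤ ℓ` on `D` and some point of `D` has `|g| < s`, then `|g| ≤ κ` on `D` whenever `s + ℓ ≤ κ`. -/
theorem abs_le_of_osc_of_exists {κ ℓ s : ℝ} (hosc : ∀ x ∈ D, ∀ y ∈ D, |g x - g y| ≤ ℓ) (hsℓ : s + ℓ ≤ κ)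
    {x₀ : ℝ} (hx₀ : x₀ ∈ D) (hs : |g x₀| < s) : ∀ x ∈ D, |g x| ≤ κ := by
  intro x hx
  have h1 := hosc x hx x₀ hx₀
  have h2 : |g x| ≤ |g x - g x₀| + |g x₀| := by
    have := abs_add_le (g x - g x₀) (g x₀)
    rwa [sub_add_cancel] at this
  linarith

/-- The sublevel set is empty (hence null) if no point of `D` has `|g| < s`. -/
theorem volume_sublevel_eq_zero_of_forall {s : ℝ} (h : ∀ x ∈ D, s ≤ |g x|) : volume {x ∈ D | |g x| < s} = 0 := by
  have : {x ∈ D | |g x| < s} = ∅ := by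
    ext x
    simp only [mem_setOf_eq, mem_empty_iff_false, iff_false, not_and, not_lt]
    exact h x
  rw [this, measure_empty]

/-- **ONE CELL, FIRST ORDER.**  `D` convex, `g ∈ C¹` oscillating by `≤ ℓ` on `D`, `s + ℓ ≤ κ`, and the dichotomy `|g x| ≤ κ → c₁ ≤ |g′ x|` on `D`
(`c₁ > 0`) ⟹ `vol{x ∈ D : |g x| < s} ≤ 2s/c₁`.  (If the cell meets the shell at all, the whole cell is in `{|g| ≤ κ}`, where the slope floor holds.)
[cite: FeldmanSalmhoferTrubowitz1998, §3] -/
theorem volume_sublevel_cell_le_of_dichotomy_one (hD : Convex ℝ D) (hg : ContDiff ℝ 1 g) {κ c₁ ℓ s : ℝ} (hc₁ : 0 < c₁)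
    (hosc : ∀ x ∈ D, ∀ y ∈ D, |g x - g y| ≤ ℓ) (hsℓ : s + ℓ ≤ κ) (hdich : ∀ x ∈ D, |g x| ≤ κ → c₁ ≤ |deriv g x|) :
    volume {x ∈ D | |g x| < s} ≤ ENNReal.ofReal (2 * s / c₁) := by
  by_cases hne : ∃ x₀ ∈ D, |g x₀| < s
  · obtain ⟨x₀, hx₀D, hx₀⟩ := hne
    have hsmall := abs_le_of_osc_of_exists hosc hsℓ hx₀D hx₀
    have hderiv : ∀ x ∈ D, HasDerivAt g (deriv g x) x := fun x _ => ((hg.differentiable one_ne_zero) x).hasDerivAt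
    have hcont : ContinuousOn (deriv g) D := (hg.continuous_deriv le_rfl).continuousOn
    exact Literature.Analysis.Fourier.volume_sublevel_le_of_le_abs_deriv hD hderiv hcont hc₁ (fun x hx => hdich x hx (hsmall x hx)) s
  · push Not at hne
    rw [volume_sublevel_eq_zero_of_forall hne]
    exact bot_le

/-- **ONE CELL, SECOND ORDER.**  `D` convex, `g ∈ C²` with `g` oscillating by `≤ ℓ₀` and `g′` by `≤ ℓ₁` on `D`, `s + ℓ₀ ≤ κ`, `2ℓ₁ ≤ c₁`, and the dichotomy
`|g x| ≤ κ → |g′ x| < c₁ → c₂ ≤ |g″ x|` on `D` (`c₁, c₂, s > 0`) ⟹ `vol{x ∈ D : |g x| < s} ≤ 4s/c₁ + 6√(s/c₂)`: either the slope floor `c₁/2` holds on the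
whole cell (first-order lemma), or some slope is `< c₁/2`, hence every slope is `< c₁`, hence the curvature floor holds on the whole cell (second-order
lemma). [cite: FeldmanSalmhoferTrubowitz1998, §3] -/
theorem volume_sublevel_cell_le_of_dichotomy_two (hD : Convex ℝ D) (hg : ContDiff ℝ 2 g) {κ c₁ c₂ ℓ₀ ℓ₁ s : ℝ} (hc₁ : 0 < c₁) (hc₂ : 0 < c₂)
    (hs : 0 < s) (hosc₀ : ∀ x ∈ D, ∀ y ∈ D, |g x - g y| ≤ ℓ₀) (hosc₁ : ∀ x ∈ D, ∀ y ∈ D, |deriv g x - deriv g y| ≤ ℓ₁) (hsℓ : s + ℓ₀ ≤ κ)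
    (hℓ₁ : 2 * ℓ₁ ≤ c₁) (hdich : ∀ x ∈ D, |g x| ≤ κ → |deriv g x| < c₁ → c₂ ≤ |iteratedDeriv 2 g x|) :
    volume {x ∈ D | |g x| < s} ≤ ENNReal.ofReal (4 * s / c₁ + 6 * Real.sqrt (s / c₂)) := by
  have h4 : 0 ≤ 4 * s / c₁ := by positivity
  have h6 : 0 ≤ 6 * Real.sqrt (s / c₂) := by positivity
  by_cases hne : ∃ x₀ ∈ D, |g x₀| < s
  · obtain ⟨x₀, hx₀D, hx₀⟩ := hne
    have hsmall := abs_le_of_osc_of_exists hosc₀ hsℓ hx₀D hx₀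
    have hderiv : ∀ x ∈ D, HasDerivAt g (deriv g x) x := fun x _ => hasDerivAt_of_two hg x
    have hcont : ContinuousOn (deriv g) D := (hg.continuous_deriv (by norm_num)).continuousOn
    by_cases hslope : ∀ x ∈ D, c₁ / 2 ≤ |deriv g x|
    · have h := Literature.Analysis.Fourier.volume_sublevel_le_of_le_abs_deriv hD hderiv hcont (half_pos hc₁) hslope s
      refine h.trans (ENNReal.ofReal_le_ofReal ?_)
      have : 2 * s / (c₁ / 2) = 4 * s / c₁ := by
        field_simp
        ring
      rw [this]
      linarith
    · push Not at hslope
      obtain ⟨x₁, hx₁D, hx₁⟩ := hslope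
      have hslope' : ∀ x ∈ D, |deriv g x| < c₁ := fun x hx => by
        have h1 := hosc₁ x hx x₁ hx₁D
        have h2 : |deriv g x| ≤ |deriv g x - deriv g x₁| + |deriv g x₁| := by
          have := abs_add_le (deriv g x - deriv g x₁) (deriv g x₁)
          rwa [sub_add_cancel] at this
        linarith
      have hfloor : ∀ x ∈ D, c₂ ≤ |iteratedDeriv 2 g x| := fun x hx => hdich x hx (hsmall x hx) (hslope' x hx)
      have hderiv2 : ∀ x ∈ D, HasDerivAt (deriv g) (iteratedDeriv 2 g x) x := fun x _ => hasDerivAt_deriv_of_two hg x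
      have hcont2 : ContinuousOn (iteratedDeriv 2 g) D := (hg.continuous_iteratedDeriv 2 le_rfl).continuousOn
      have h := Literature.Analysis.Fourier.volume_sublevel_le_of_le_abs_deriv2 hD hderiv hderiv2 hcont2 hc₂ hfloor hs
      refine h.trans (ENNReal.ofReal_le_ofReal ?_)
      linarith
  · push Not at hne
    rw [volume_sublevel_eq_zero_of_forall hne]
    exact bot_le

end Cell

/-! ## §2 Grid: localisation on subintervals of length `≤ h` -/

section Grid

variable {g : ℝ → ℝ} {a b : ℝ}

/-- **LOCALISATION.**  If every subinterval `[a′,b′] ⊆ [A,B]` of length `≤ h` (`h > 0`) satisfies `vol{x ∈ [a′,b′] : P x} ≤ V`, then every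
`[a′,b′] ⊆ [A,B]` of length `≤ N·h` satisfies `vol{x ∈ [a′,b′] : P x} ≤ N·V` (induction on `N`: peel off one cell of length `h`). [folklore] -/
theorem volume_sublevel_Icc_le_mul_of_cells {P : ℝ → Prop} {A B h : ℝ} (hh : 0 < h) {V : ℝ≥0∞}
    (hcell : ∀ a' b', A ≤ a' → b' ≤ B → a' ≤ b' → b' - a' ≤ h → volume {x ∈ Icc a' b' | P x} ≤ V) :
    ∀ (N : ℕ) (a' b' : ℝ), A ≤ a' → b' ≤ B → a' ≤ b' → b' - a' ≤ N * h → volume {x ∈ Icc a' b' | P x} ≤ N * V := by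
  intro N
  induction N with
  | zero =>
      intro a' b' _ _ hab hN
      have hba : b' = a' := le_antisymm (by simpa using hN) hab
      subst hba
      have hsub : {x ∈ Icc b' b' | P x} ⊆ Icc b' b' := fun x hx => hx.1
      calc volume {x ∈ Icc b' b' | P x} ≤ volume (Icc b' b') := measure_mono hsub
        _ = 0 := by rw [Real.volume_Icc, sub_self, ENNReal.ofReal_zero]
        _ ≤ _ := bot_le
  | succ N ih =>
      intro a' b' hAa hbB hab hN
      by_cases hsmall : b' - a' ≤ h
      · calc volume {x ∈ Icc a' b' | P x} ≤ V := hcell a' b' hAa hbB hab hsmall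
          _ = 1 * V := (one_mul V).symm
          _ ≤ ((N + 1 : ℕ) : ℝ≥0∞) * V := by
              gcongr
              exact_mod_cast Nat.succ_le_succ (Nat.zero_le N)
      · push Not at hsmall
        have hsplit : {x ∈ Icc a' b' | P x} ⊆ {x ∈ Icc a' (a' + h) | P x} ∪ {x ∈ Icc (a' + h) b' | P x} := by
          intro x hx
          rcases le_total x (a' + h) with hle | hge
          · exact Or.inl ⟨⟨hx.1.1, hle⟩, hx.2⟩
          · exact Or.inr ⟨⟨hge, hx.1.2⟩, hx.2⟩
        have h1 : volume {x ∈ Icc a' (a' + h) | P x} ≤ V := hcell a' (a' + h) hAa (by linarith) (by linarith) (by linarith)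
        have hN' : b' - (a' + h) ≤ N * h := by push_cast at hN; linarith
        have h2 : volume {x ∈ Icc (a' + h) b' | P x} ≤ N * V := ih (a' + h) b' (by linarith) hbB (by linarith) hN'
        calc volume {x ∈ Icc a' b' | P x} ≤ volume ({x ∈ Icc a' (a' + h) | P x} ∪ {x ∈ Icc (a' + h) b' | P x}) := measure_mono hsplit
          _ ≤ volume {x ∈ Icc a' (a' + h) | P x} + volume {x ∈ Icc (a' + h) b' | P x} := measure_union_le _ _
          _ ≤ V + N * V := add_le_add h1 h2
          _ = ((N + 1 : ℕ) : ℝ≥0∞) * V := by push_cast; rw [add_mul, one_mul, add_comm]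

/-- Oscillation of `g` on a subinterval from a slope ceiling: `|g′| ≤ L` on `[a,b]` ⟹ `|g x − g y| ≤ L·(b′ − a′)` for `x, y ∈ [a′,b′] ⊆ [a,b]`. -/
theorem abs_sub_le_of_deriv_le (hg : ContDiff ℝ 1 g) {L : ℝ} (hL : ∀ x ∈ Icc a b, |deriv g x| ≤ L) {a' b' : ℝ} (ha : a ≤ a') (hb : b' ≤ b) :
    ∀ x ∈ Icc a' b', ∀ y ∈ Icc a' b', |g x - g y| ≤ L * (b' - a') := by
  intro x hx y hy
  have hdiff : ∀ z ∈ Icc a' b', DifferentiableAt ℝ g z := fun z _ => (hg.differentiable one_ne_zero) z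
  have hbound : ∀ z ∈ Icc a' b', ‖deriv g z‖ ≤ L := fun z hz => by
    rw [Real.norm_eq_abs]; exact hL z ⟨ha.trans hz.1, hz.2.trans hb⟩
  have h := (convex_Icc a' b').norm_image_sub_le_of_norm_deriv_le hdiff hbound hy hx
  rw [Real.norm_eq_abs, Real.norm_eq_abs] at h
  have hL0 : 0 ≤ L := (abs_nonneg _).trans (hL x ⟨ha.trans hx.1, hx.2.trans hb⟩)
  have hxy : |x - y| ≤ b' - a' := by
    rw [abs_le]; constructor <;> linarith [hx.1, hx.2, hy.1, hy.2]
  exact h.trans (mul_le_mul_of_nonneg_left hxy hL0)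

/-- **SUBLEVEL COUNTING, FIRST ORDER.**  `g ∈ C¹` on `[a,b]` with slope ceiling `|g′| ≤ L₁` and the dichotomy `|g x| ≤ κ → c₁ ≤ |g′ x|` (`κ, c₁, L₁ > 0`);
`N` a natural with `(b − a)·2L₁ ≤ N·κ` (i.e. `N` cells of length `κ/(2L₁)`).  Then for `s ≤ κ/2`:
`vol{x ∈ [a,b] : |g x| < s} ≤ N · (2s/c₁)`. [cite: FeldmanSalmhoferTrubowitz1998, §3] -/
theorem volume_sublevel_Icc_le_of_dichotomy_one (hab : a ≤ b) (hg : ContDiff ℝ 1 g) {κ c₁ L₁ s : ℝ} {N : ℕ} (hκ : 0 < κ) (hc₁ : 0 < c₁)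
    (hL₁ : 0 < L₁) (hL : ∀ x ∈ Icc a b, |deriv g x| ≤ L₁) (hdich : ∀ x ∈ Icc a b, |g x| ≤ κ → c₁ ≤ |deriv g x|)
    (hN : (b - a) * (2 * L₁) ≤ N * κ) (hs : s ≤ κ / 2) :
    volume {x ∈ Icc a b | |g x| < s} ≤ N * ENNReal.ofReal (2 * s / c₁) := by
  have hh : 0 < κ / (2 * L₁) := by positivity
  refine volume_sublevel_Icc_le_mul_of_cells (P := fun x => |g x| < s) hh ?_ N a b le_rfl le_rfl hab ?_
  · intro a' b' ha hb hab' hlen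
    have hosc := abs_sub_le_of_deriv_le hg hL ha hb
    refine volume_sublevel_cell_le_of_dichotomy_one (convex_Icc a' b') hg hc₁ hosc ?_ fun x hx => hdich x ⟨ha.trans hx.1, hx.2.trans hb⟩
    have : L₁ * (b' - a') ≤ κ / 2 := by
      calc L₁ * (b' - a') ≤ L₁ * (κ / (2 * L₁)) := mul_le_mul_of_nonneg_left hlen hL₁.le
        _ = κ / 2 := by field_simp
    linarith
  · calc b - a = (b - a) * (2 * L₁) / (2 * L₁) := by field_simp
      _ ≤ N * κ / (2 * L₁) := by gcongr
      _ = N * (κ / (2 * L₁)) := by ring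

/-- **SUBLEVEL COUNTING, SECOND ORDER.**  `g ∈ C²` on `[a,b]` with ceilings `|g′| ≤ L₁`, `|g″| ≤ L₂` and the dichotomy `|g x| ≤ κ → |g′ x| < c₁ → c₂ ≤ |g″ x|`
(`κ, c₁, c₂, L₁, L₂ > 0`); `N` a natural with `(b − a)·2L₁ ≤ N·κ` and `(b − a)·4L₂ ≤ N·c₁`.  Then for `0 < s ≤ κ/2`:
`vol{x ∈ [a,b] : |g x| < s} ≤ N·(4s/c₁ + 6√(s/c₂))`. [cite: FeldmanSalmhoferTrubowitz1998, §3] -/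
theorem volume_sublevel_Icc_le_of_dichotomy_two (hab : a ≤ b) (hg : ContDiff ℝ 2 g) {κ c₁ c₂ L₁ L₂ s : ℝ} {N : ℕ} (hκ : 0 < κ) (hc₁ : 0 < c₁)
    (hc₂ : 0 < c₂) (hL₁ : 0 < L₁) (hL₂ : 0 < L₂) (hL : ∀ x ∈ Icc a b, |deriv g x| ≤ L₁) (hL' : ∀ x ∈ Icc a b, |iteratedDeriv 2 g x| ≤ L₂)
    (hdich : ∀ x ∈ Icc a b, |g x| ≤ κ → |deriv g x| < c₁ → c₂ ≤ |iteratedDeriv 2 g x|)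
    (hN : (b - a) * (2 * L₁) ≤ N * κ) (hN' : (b - a) * (4 * L₂) ≤ N * c₁) (hs0 : 0 < s) (hs : s ≤ κ / 2) :
    volume {x ∈ Icc a b | |g x| < s} ≤ N * ENNReal.ofReal (4 * s / c₁ + 6 * Real.sqrt (s / c₂)) := by
  -- cell length: the smaller of `κ/(2L₁)` and `c₁/(4L₂)`
  set h : ℝ := min (κ / (2 * L₁)) (c₁ / (4 * L₂)) with hh_def
  have hh : 0 < h := lt_min (by positivity) (by positivity)
  have hg1 : ContDiff ℝ 1 (deriv g) := contDiff_one_deriv_of_two hg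
  have hL'1 : ∀ x ∈ Icc a b, |deriv (deriv g) x| ≤ L₂ := fun x hx => by
    have e : deriv (deriv g) = iteratedDeriv 2 g := by
      rw [show (2 : ℕ) = 1 + 1 from rfl, iteratedDeriv_succ, iteratedDeriv_one]
    rw [e]; exact hL' x hx
  refine volume_sublevel_Icc_le_mul_of_cells (P := fun x => |g x| < s) hh ?_ N a b le_rfl le_rfl hab ?_
  · intro a' b' ha hb hab' hlen
    have hosc₀ := abs_sub_le_of_deriv_le (hg.of_le (by norm_num)) hL ha hb
    have hosc₁ := abs_sub_le_of_deriv_le hg1 hL'1 ha hb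
    refine volume_sublevel_cell_le_of_dichotomy_two (convex_Icc a' b') hg hc₁ hc₂ hs0 hosc₀ hosc₁ ?_ ?_
      fun x hx => hdich x ⟨ha.trans hx.1, hx.2.trans hb⟩
    · have : L₁ * (b' - a') ≤ κ / 2 := by
        calc L₁ * (b' - a') ≤ L₁ * (κ / (2 * L₁)) := mul_le_mul_of_nonneg_left (hlen.trans (min_le_left _ _)) hL₁.le
          _ = κ / 2 := by field_simp
      linarith
    · calc 2 * (L₂ * (b' - a')) ≤ 2 * (L₂ * (c₁ / (4 * L₂))) := by gcongr; exact hlen.trans (min_le_right _ _)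
        _ = c₁ / 2 := by field_simp; ring
        _ ≤ c₁ := by linarith
  · -- `b - a ≤ N * h` from both grid conditions
    rcases le_total (κ / (2 * L₁)) (c₁ / (4 * L₂)) with hle | hle
    · rw [hh_def, min_eq_left hle]
      calc b - a = (b - a) * (2 * L₁) / (2 * L₁) := by field_simp
        _ ≤ N * κ / (2 * L₁) := by gcongr
        _ = N * (κ / (2 * L₁)) := by ring
    · rw [hh_def, min_eq_right hle]
      calc b - a = (b - a) * (4 * L₂) / (4 * L₂) := by field_simp
        _ ≤ N * c₁ / (4 * L₂) := by gcongr
        _ = N * (c₁ / (4 * L₂)) := by ring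

end Grid

end Summit.HubbardSuperconductivity.HubbardSuperconductivity.Theorems.C4a

end
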